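import Summits.CriticalPhenomena.PercolationContinuityZ3.Theorems.PercNearOneGluingNoHeavyLowerTailFourCopyHubTriCertAlphaData
import HarnessLib

/-!
# `NoHeavyLowerTail` (stmt-CriticalPhenomena-4575) — FOUR-copy switching certificates, IX-V0b: the triangle certificate `alphaT` for α
# source type a|b|c|y, hub base type abcy: second half of the hub states

Support file (prover prim-ineq-prove-3 gen 8; generated by work/gen/gen_tri_lean.py --split; `--supports stmt-CriticalPhenomena-4575`,
`--computational`: the value tables are certified by compiled evaluation, `native_decide`).
-/

namespace Summit.CriticalPhenomena.PercolationContinuityZ3.Theorems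

namespace FourCopyHub

open SwitchRelax

/-- Elementwise maximum over the hub states 312..624 of base type abcy. [this work] -/
def v0litB_alphaT : List (List ℤ) :=
 [[0, 0, 0, 0, 0, 0, 0, 0, 0, 0, 0, 0, 0, 0, 0],
 [0, 0, 0, 0, 0, 0, 0, 0, 0, 0, 0, 0, 0, 0, 0],
 [0, 0, 0, 0, 0, 0, 0, 0, 0, 0, 0, 0, 0, 0, 0],
 [0, 0, 0, 0, 0, 0, 0, 0, 0, 0, 0, 0, 0, 0, 0],
 [0, 0, 0, 0, 0, 0, 0, 0, 0, 0, 0, 0, 0, 0, 0],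
 [0, 0, 0, 0, 0, 0, 0, 0, 0, 0, 0, 0, 0, 0, 0],
 [0, 0, 0, 0, 0, 0, 0, 0, 0, 0, 0, 0, 0, 0, 0],
 [0, 0, 0, 0, 0, 0, 0, 0, 0, 0, 0, 0, 0, 0, 0],
 [0, 0, 0, 0, 0, 0, 0, 0, 0, 0, 0, 0, 0, 0, 0],
 [0, 0, 0, 0, 0, 0, 0, 0, 0, 0, 0, 0, 0, 0, 0],
 [0, 0, 0, 0, 0, 0, 0, 0, 0, 0, 0, 0, 0, 0, 0],
 [0, 0, 0, 0, 0, 0, 0, 0, 0, 0, 0, 0, 0, 0, 0],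
 [0, 0, 0, 0, 0, 0, 0, 0, 0, 0, 0, 0, 0, 0, 0],
 [0, 0, 0, 0, 0, 0, 0, 0, 0, 0, 0, 0, 0, 0, 0],
 [0, 0, 0, 0, 0, 0, 0, 0, 0, 0, 0, 0, 0, 0, 0]]

set_option maxHeartbeats 0 in
/-- Second half of the hub states (compiled evaluation). [this work] -/
theorem v0litB_alphaT_eq : (((states 0 14).drop 312).map (fun s3 => triRows cert_alphaT (mkTriTabs cert_alphaT 0) (mkOT 0) 14 (triHall cert_alphaT (mkTriTabs cert_alphaT 0) (mkOT 0) 14) (triO1 cert_alphaT (mkTriTabs cert_alphaT 0) 14) (triO2 cert_alphaT (mkTriTabs cert_alphaT 0) 14) s3)).foldr tmax tbot = v0litB_alphaT := by native_decide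

end FourCopyHub

end Summit.CriticalPhenomena.PercolationContinuityZ3.Theorems
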